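import Summits.QuantumAdvantage.QuantumAdvantage.Theorems.RankDialL6
import HarnessLib

/-!
# RankDial (L7) — §39 LABEL PARITIES: WIN ⟺ `labelPar_{Z v} v ≠ 0`, multi-liveness per content (arbitrary pass patterns)

TARGET BY NAME (cell decomp-qadv, RESIDUAL MODE): item stmt-QuantumAdvantage-23109
`Summit.QuantumAdvantage.QuantumAdvantage.Theses.OddPrimeWalk.ManyReadersSqrtOdd`, through rung R5 = `AdviceFreeQNC0.WalkHardFLinSel p`.
This file SUPPORTS the item (`--supports`); it does not close it.  Declaration bodies are byte-identical to §39 of the cell node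
«BlockDial» (decomp-qadv lens-1, generation 27, part L; node file RankDialL.lean, rev 5).  For a GLOBAL classification `kind` of the
cuts of a window `L + ℓ + R` (`none` = outside the block or never passing on the outside fibre, `some j` = at the `j`-th inside position)
and a label `z ∈ ℤ₃ × ℤ₃^J`, `labelPar kind z := Σ_{g alive at z} fire_g` over `𝔽₂` (alive: `z₀ + coordOf z (kind g) ≠ deadVal g`, parts
L3/L4).  PROVED: `labelPar_apply` / `labelPar_ne_zero_iff` (the count of alive passing cuts), `dead_iff_not_live` (the per-cut dictionary of
part L4, global form), `ringWinU_glue3_iff_labelPar` (the walk game is won at `a ++ v ++ b` iff `labelPar_{blockLabel v} v ≠ 0`),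
`card_labelPar_ne_zero_le` (for every content at most `2·3^J` labels have non-zero parity — part L3's multi-liveness restricted to the pass
set) and `sum_card_labelPar_ne_zero_le` (`Σ_z #{v : labelPar_z v ≠ 0} ≤ 2·3^J·2^ℓ`).  Imports part L6.
-/

set_option linter.dupNamespace false
set_option autoImplicit false

noncomputable section
open Classical

namespace Summit.QuantumAdvantage.QuantumAdvantage.Theorems.RankDial

open Finset
open Summit.QuantumAdvantage.AdviceFreeQNC0
open Literature.Computability.MetaComplexity Literature.Computability.MetaComplexity.Smolensky

/-! ### §39 (part L «BlockDial») LABEL PARITIES (arbitrary pass patterns): WIN ⟺ `labelPar_{Z v} v ≠ 0`; multi-liveness per content -/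

section LabelGF
variable {L ℓ R : ℕ} (c : ℕ) (y : Fin (L + ℓ + R + 1) → (Fin (L + ℓ + R) → Bool) → Bool)
  (a : Fin L → Bool) (b : Fin R → Bool)

/-- **The label parity at the label `z`.**  Fix a GLOBAL classification `kind` of all cuts (outside / never-passing cuts `none`, the cut at
the `j`-th inside position `some j`).  `labelPar kind z := Σ_{g alive at z} fire_g` over `𝔽₂`, a cut being ALIVE at `z` iff
`z₀ + coordOf z (kind g) ≠ deadVal g` (§31–§32).  For FIXED `z` this is a plain sum of fire indicators: on a level set of the window forms
every fire indicator is an `s`-junta under `JRankLE … s D`, so `labelPar z` restricted there has degree `≤ s` — uniformly in the content. -/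
def labelPar {J : ℕ} (kind : Fin (L + ℓ + R + 1) → Option (Fin J)) (z : ZMod 3 × (Fin J → ZMod 3)) : CubeFn (ZMod 2) ℓ :=
  ∑ g ∈ univ.filter (fun g : Fin (L + ℓ + R + 1) => z.1 + coordOf z (kind g) ≠ deadVal ℓ c a b g.val), fireFn y a b g

/-- `labelPar z v` is the number of cuts alive at `z` and passing at `a ++ v ++ b`, read in `𝔽₂`. -/
theorem labelPar_apply {J : ℕ} (kind : Fin (L + ℓ + R + 1) → Option (Fin J)) (z : ZMod 3 × (Fin J → ZMod 3))
    (v : Fin ℓ → Bool) :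
    labelPar c y a b kind z v = ((univ.filter fun g : Fin (L + ℓ + R + 1) =>
      z.1 + coordOf z (kind g) ≠ deadVal ℓ c a b g.val ∧ y g (glue3 a v b) = true).card : ZMod 2) := by
  unfold labelPar
  rw [Finset.sum_apply]
  simp only [fireFn]
  rw [Finset.sum_boole, Finset.filter_filter]

/-- `(N : 𝔽₂) ≠ 0 ↔ N` odd. -/
theorem natMod2_ne_zero_iff (N : ℕ) : (N : ZMod 2) ≠ 0 ↔ N % 2 = 1 := by
  rw [Ne, ZMod.natCast_eq_zero_iff, Nat.two_dvd_ne_zero]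

/-- `labelPar z v ≠ 0 ⟺` an odd number of cuts alive at `z` pass. -/
theorem labelPar_ne_zero_iff {J : ℕ} (kind : Fin (L + ℓ + R + 1) → Option (Fin J)) (z : ZMod 3 × (Fin J → ZMod 3))
    (v : Fin ℓ → Bool) :
    labelPar c y a b kind z v ≠ 0 ↔ (univ.filter fun g : Fin (L + ℓ + R + 1) =>
      z.1 + coordOf z (kind g) ≠ deadVal ℓ c a b g.val ∧ y g (glue3 a v b) = true).card % 2 = 1 := by
  rw [labelPar_apply, natMod2_ne_zero_iff]

/-- **The per-cut dictionary, global form** (§32 Step 3 for a cut classified in the whole cut set): a cut outside the block (`kind = none`,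
`g ≤ L ∨ L + ℓ ≤ g`) or at the inside position `h j` (`kind = some j`) is DEAD at the block label of `v` iff it is not live at `a ++ v ++ b`
in the walk game. -/
theorem dead_iff_not_live {J : ℕ} (h : Fin J → ℕ) (kind : Fin (L + ℓ + R + 1) → Option (Fin J))
    (g : Fin (L + ℓ + R + 1)) (v : Fin ℓ → Bool)
    (hnone : kind g = none → (g.val ≤ L ∨ L + ℓ ≤ g.val))
    (hsome : ∀ j, kind g = some j → g.val = h j ∧ L < h j ∧ h j < L + ℓ) :
    ((blockLabel L h v).1 + coordOf (blockLabel L h v) (kind g) = deadVal ℓ c a b g.val) ↔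
      ¬ ((c + g.val + walkExp (glue3 a v b) g.val) % 3 ≠ 0) := by
  have hwt : wt (glue3 a v b) = wt a + wt v + wt b := wt_glue3 a v b
  cases hk : kind g with
  | none =>
    by_cases hle : g.val ≤ L
    · have hpre : wtPrefix (glue3 a v b) g.val = wtPrefix a g.val := wtPrefix_glue3_of_le a v b hle
      have hexp : c + g.val + walkExp (glue3 a v b) g.val =
          (c + g.val + wt a + wt b + wtPrefix a g.val) + wt v := by
        unfold walkExp; rw [hwt, hpre]; omega
      simp only [coordOf, blockLabel, deadVal, if_pos hle]
      rw [hexp, natMod3_ne_zero_iff, Nat.cast_add (R := ZMod 3) (c + g.val + wt a + wt b + wtPrefix a g.val) (wt v)]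
      exact zmod3_solve_left _ _
    · have hge : L + ℓ ≤ g.val := by
        rcases hnone hk with h' | h'
        · exact absurd h' hle
        · exact h'
      have hpre : wtPrefix (glue3 a v b) g.val = wt a + wt v + wtPrefix b (g.val - (L + ℓ)) :=
        wtPrefix_glue3_of_ge a v b hge
      have hexp : c + g.val + walkExp (glue3 a v b) g.val =
          (c + g.val + wt a + wt b + wt a + wtPrefix b (g.val - (L + ℓ))) + 2 * wt v := by
        unfold walkExp; rw [hwt, hpre]; omega
      simp only [coordOf, blockLabel, deadVal, if_neg hle, if_pos hge]
      rw [hexp, natMod3_ne_zero_iff,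
        Nat.cast_add (R := ZMod 3) (c + g.val + wt a + wt b + wt a + wtPrefix b (g.val - (L + ℓ))) (2 * wt v),
        Nat.cast_mul (α := ZMod 3) 2 (wt v), Nat.cast_ofNat]
      exact zmod3_solve_right _ _
  | some j =>
    obtain ⟨hg, hj1, hj2⟩ := hsome j hk
    have hpre : wtPrefix (glue3 a v b) g.val = wt a + wtPrefix v (g.val - L) :=
      wtPrefix_glue3_of_mem a b v (by omega) (by omega)
    have hexp : c + g.val + walkExp (glue3 a v b) g.val =
        (c + g.val + 2 * wt a + wt b) + wt v + wtPrefix v (h j - L) := by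
      unfold walkExp; rw [hwt, hpre, hg]; omega
    have hn1 : ¬ g.val ≤ L := by omega
    have hn2 : ¬ L + ℓ ≤ g.val := by omega
    simp only [coordOf, blockLabel, deadVal, if_neg hn1, if_neg hn2]
    rw [hexp, natMod3_ne_zero_iff, Nat.cast_add (R := ZMod 3) (c + g.val + 2 * wt a + wt b + wt v) (wtPrefix v (h j - L)),
      Nat.cast_add (R := ZMod 3) (c + g.val + 2 * wt a + wt b) (wt v)]
    exact zmod3_solve_mid _ _ _

/-- **WIN ⟺ the label parity AT THE OWN LABEL is non-zero.**  For a global classification (`none` ⟹ outside the block OR never passing on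
this outside fibre; `some j` ⟹ at the inside position `h j`): `ringWinU c y (a ++ v ++ b) = true ↔ labelPar kind (blockLabel L h v) v ≠ 0`. -/
theorem ringWinU_glue3_iff_labelPar {J : ℕ} (h : Fin J → ℕ) (kind : Fin (L + ℓ + R + 1) → Option (Fin J))
    (hnone : ∀ g, kind g = none → (g.val ≤ L ∨ L + ℓ ≤ g.val ∨ ∀ v : Fin ℓ → Bool, y g (glue3 a v b) = false))
    (hsome : ∀ g j, kind g = some j → g.val = h j ∧ L < h j ∧ h j < L + ℓ) (v : Fin ℓ → Bool) :
    ringWinU c y (glue3 a v b) = true ↔ labelPar c y a b kind (blockLabel L h v) v ≠ 0 := by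
  rw [labelPar_ne_zero_iff]
  unfold ringWinU
  rw [decide_eq_true_iff]
  have hout : ∀ g : Fin (L + ℓ + R + 1), y g (glue3 a v b) = true → (kind g = none → (g.val ≤ L ∨ L + ℓ ≤ g.val)) := by
    intro g hp hk
    rcases hnone g hk with h1 | h1 | h1
    · exact Or.inl h1
    · exact Or.inr h1
    · rw [h1 v] at hp
      exact absurd hp Bool.false_ne_true
  have hF : (univ.filter fun g : Fin (L + ℓ + R + 1) =>
      y g (glue3 a v b) = true ∧ (c + g.val + walkExp (glue3 a v b) g.val) % 3 ≠ 0) =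
      univ.filter fun g : Fin (L + ℓ + R + 1) =>
        (blockLabel L h v).1 + coordOf (blockLabel L h v) (kind g) ≠ deadVal ℓ c a b g.val ∧ y g (glue3 a v b) = true := by
    refine Finset.filter_congr fun g _ => ?_
    constructor
    · rintro ⟨hp, hl⟩
      refine ⟨?_, hp⟩
      rw [Ne, dead_iff_not_live c a b h kind g v (hout g hp) (hsome g), not_not]
      exact hl
    · rintro ⟨ha, hp⟩
      refine ⟨hp, ?_⟩
      rw [Ne, dead_iff_not_live c a b h kind g v (hout g hp) (hsome g), not_not] at ha
      exact ha
  rw [hF]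

/-- **Multi-liveness for label parities**: for every content `v`, at most `2·3^J` labels `z` have `labelPar z v ≠ 0` — restrict the
classification to the pass set of `v`; then `labelPar z v ≠ 0 ↔ WinLabel z` (§31) and `card_winLabel_le` applies. -/
theorem card_labelPar_ne_zero_le {J : ℕ} (kind : Fin (L + ℓ + R + 1) → Option (Fin J)) (v : Fin ℓ → Bool) :
    (univ.filter fun z : ZMod 3 × (Fin J → ZMod 3) => labelPar c y a b kind z v ≠ 0).card ≤ 2 * 3 ^ J := by
  set P := univ.filter fun g : Fin (L + ℓ + R + 1) => y g (glue3 a v b) = true with hP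
  have key : ∀ z : ZMod 3 × (Fin J → ZMod 3), labelPar c y a b kind z v ≠ 0 ↔
      WinLabel (fun g : {g // g ∈ P} => kind g.1) (fun g => deadVal ℓ c a b g.1.val) z := by
    intro z
    rw [labelPar_ne_zero_iff]
    unfold WinLabel deadCount
    have h2 : (P.filter fun g => z.1 + coordOf z (kind g) = deadVal ℓ c a b g.val).card =
        (univ.filter fun g : {g // g ∈ P} => z.1 + coordOf z (kind g.1) = deadVal ℓ c a b g.1.val).card := by
      rw [Finset.card_filter, Finset.card_filter]
      exact Finset.sum_subtype P (fun _ => Iff.rfl)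
        (fun g : Fin (L + ℓ + R + 1) => if z.1 + coordOf z (kind g) = deadVal ℓ c a b g.val then 1 else 0)
    have h5 := Finset.card_filter_add_card_filter_not (s := P)
      (fun g : Fin (L + ℓ + R + 1) => z.1 + coordOf z (kind g) = deadVal ℓ c a b g.val)
    have h6 : Fintype.card {g // g ∈ P} = P.card := Fintype.card_coe P
    have h7 : (univ.filter fun g : Fin (L + ℓ + R + 1) =>
        z.1 + coordOf z (kind g) ≠ deadVal ℓ c a b g.val ∧ y g (glue3 a v b) = true).card =
        (P.filter fun g => ¬ (z.1 + coordOf z (kind g) = deadVal ℓ c a b g.val)).card := by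
      rw [hP, Finset.filter_filter]
      exact congrArg Finset.card (Finset.filter_congr fun g _ => and_comm)
    rw [← h2, h6, h7]
    omega
  calc (univ.filter fun z : ZMod 3 × (Fin J → ZMod 3) => labelPar c y a b kind z v ≠ 0).card
      = (univ.filter fun z => WinLabel (fun g : {g // g ∈ P} => kind g.1) (fun g => deadVal ℓ c a b g.1.val) z).card :=
        congrArg Finset.card (Finset.filter_congr fun z _ => key z)
    _ ≤ 2 * 3 ^ J := card_winLabel_le _ _

/-- Summing multi-liveness over the contents: `Σ_z #{v : labelPar z v ≠ 0} ≤ 2·3^J·2^ℓ`. -/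
theorem sum_card_labelPar_ne_zero_le {J : ℕ} (kind : Fin (L + ℓ + R + 1) → Option (Fin J)) :
    ∑ z : ZMod 3 × (Fin J → ZMod 3), (univ.filter fun v : Fin ℓ → Bool => labelPar c y a b kind z v ≠ 0).card ≤
      2 * 3 ^ J * 2 ^ ℓ := by
  calc ∑ z : ZMod 3 × (Fin J → ZMod 3), (univ.filter fun v : Fin ℓ → Bool => labelPar c y a b kind z v ≠ 0).card
      = ∑ z : ZMod 3 × (Fin J → ZMod 3), ∑ v : Fin ℓ → Bool, (if labelPar c y a b kind z v ≠ 0 then 1 else 0) := by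
        simp_rw [Finset.card_filter]
    _ = ∑ v : Fin ℓ → Bool, ∑ z : ZMod 3 × (Fin J → ZMod 3), (if labelPar c y a b kind z v ≠ 0 then 1 else 0) :=
        Finset.sum_comm
    _ = ∑ v : Fin ℓ → Bool, (univ.filter fun z : ZMod 3 × (Fin J → ZMod 3) => labelPar c y a b kind z v ≠ 0).card := by
        simp_rw [Finset.card_filter]
    _ ≤ ∑ _v : Fin ℓ → Bool, 2 * 3 ^ J := Finset.sum_le_sum fun v _ => card_labelPar_ne_zero_le c y a b kind v
    _ = 2 * 3 ^ J * 2 ^ ℓ := by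
        rw [Finset.sum_const, Finset.card_univ, Fintype.card_fun, Fintype.card_bool, Fintype.card_fin, smul_eq_mul]
        ring

end LabelGF

end Summit.QuantumAdvantage.QuantumAdvantage.Theorems.RankDial
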